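import Summits.QuantumFields.YangMills.Theorems.BalabanUVNodesN09B12ZeroLetterFlatness

/-!
# NODE N09 ([Balaban1987RG1] Lemma 4 (3.53) p. 280), FLAG №7 LOCATED RIDER 3, PART 3 — THE ZERO-LETTER FLATNESS `δ₀` LIES STRICTLY INSIDE THE (1.16) WINDOW:
# under print's restrictions and the smallness `β ≤ ½`, `α₁ ≤ ¼`, `δ₀ < (1+2β)α₀ξ′²` — the second-order flatness that `𝐊 = 0` forces on the datum's pinned background
# (PART 1) is strictly stronger than the first-order plaquette window condition (iv) imposes on every element of `U′ᶜ_{k+1}(□₀, (1+2β)α₀, (1+2β)α₁, α₀)`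

T. Bałaban, *Renormalization group approach to lattice gauge field theories. I*, Commun. Math. Phys. **109** (1987) 249–301 [Balaban1987RG1] (= [I]), (1.16) p. 262, §3
pp. 275–280.  TRACK A (YM-PLAN §2b), WIDTH SEAT `pub-ymgap-dag-n09-w5` (HUMAN RULING D-0154 ∕ director-ym R399 (3a)), generation g2; LOCATED RIDER to FLAG №7 of record
(director-ym №209), part 3 after PART 1 p611726 `…N09B12ZeroLetterFlatness` (zero `𝐊` at `τ = 1` ⇒ the datum's pinned `(k+1)`-background is `δ₀`-flat on `X`) and PART 2
p612606 `…N09B12FailingLemmaUnderOrbitTie` (orbit-tie ∧ NF(δ₀) ⇒ №209's lemma; tie alone idle at `RzOfRecord`).  Key of record it serves: K1⁷ `StabilityBAtRecordR13SepCoPH`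
= stmt-QuantumFields-20542 (`--supports`, helper; count-neutral).

WHY.  PART 2's non-flatness hypothesis NF(δ₀) asks for an ADMISSIBLE input (an element of the union of orbits `U′ᶜ_{k+1}(□₀, (1+2β)α₀, (1+2β)α₁, α₀)`) all of whose
(i)–(iv)-representatives have an `X`-plaquette of their pinned `(k+1)`-background off `1` by MORE than `δ₀`; condition (iv) (1.16) bounds those very plaquettes by
`(1+2β)α₀ξ′²` from above (pub-balaban `CondIV.plaq_lt` inside `Satisfies`).  If `δ₀` exceeded that window, NF(δ₀) would be refuted by admissibility alone and PART 2 §3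
would be vacuous.  THIS FILE shows it does not: with the scale identity `ξ·L^{j−1}η = L⁻¹η = ξ′` (p. 275), `δ₀ = e^{c_w}·ξ′²·(2B₃u² + 8a²e^{4aξ′})`, `a = B₃²O(1)Mα₀`,
`u = B₃O(1)Mα₀ ≤ a`, `c_w = O(1)Mα₁ + 2u + a`; print's restrictions `(4B₃²O(1)M)²α₀ ≤ β` (p. 278), `O(1)Mα₁ ≤ β`, `B₃²O(1)Mα₀ < ½α₁` (p. 277), `B₃ ≥ 1` give
`16a² ≤ βα₀`, `B₃u² ≤ a²`, and with the smallness `β ≤ ½`, `α₁ ≤ ¼` («α₀, α₁, α₂, α₃ sufficiently small», Lemma 4 p. 280; [Balaban1988Convergent] p. 261 «e.g. β = ¼»;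
dag-n09-c's witness has `β = 3∕10`, `α₁ = 3∕160`) the exponentials are `≤ 1 + x + x²` (`|x| ≤ 1`, Mathlib `Real.abs_exp_sub_one_sub_id_le`), whence
`δ₀ ≤ (1 + (β + ⅜) + (β + ⅜)²)·βα₀ξ′² < (1+2β)α₀ξ′²`.  So the interval `(δ₀, (1+2β)α₀ξ′²)` of admissible-but-not-δ₀-flat plaquette deviations is NON-EMPTY: NF(δ₀) is a
condition on the PIN of `bgI` (edit (P)), not an arithmetic impossibility.  Whether print's averaged [15]-minimisers realise it (they should: a constant-curvature abelian
small field has `|∂U_{k+1} − 1|` of first order) is the content of (P), not claimed here.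

WHAT IS PROVED (real arithmetic; theorems only, def-free, sorry-free, standard axioms).
* §1 (generic constants `c : Lemma4Consts`, any `ξ, j, η, ξ′` with `ξ·L^{j−1}η = ξ′`, `0 < ξ′ ≤ 1`) ★ `delta0_lt_window`: PART 1's `δ₀` `< (1+2β)α₀ξ′²` under the displayed
  restrictions and smallness (private `exp_le_one_add_add_sq`, `window_poly`, `one_add_add_sq_le`); `delta0_lt_window_hyps_inhabited` (A6: the antecedent is satisfiable).
* §2 (NODE 00's objects) `csX_ξ_mul_scale` (`ξ_j·L^{j−1}η_k = ξ_{k+1}` for the constants of record, `1 ≤ j`), ★★ `delta0_lt_window_of_record`: for a residual layer `λ` with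
  the displayed restrictions ∕ smallness on `λ.consts`, PART 1's `δ₀(λ)` `< (1+2β)α₀·ξ′²`, `ξ′ = (λ.csBox cB).ξ = L^{−(k+1)}` — the constant in `CondIV` of the frame `□̃⁵` at
  the radius `(1+2β)α₀` of `B12Package.inputs`' domain.

HONEST FRAMING: LOCATED, count-neutral real-arithmetic bookkeeping on OUR constant `δ₀` and print's DISPLAYED restrictions (hypothesis-form: `β ≤ ½`, `α₁ ≤ ¼` are hypotheses,
asserted of no record); nothing of Bałaban's is proved or denied; N09 NOT discharged; FLAG №7 neither closed nor widened; K0⁷ ∕ K1⁷ NOT closed; counts unmoved (typed 28∕28 ·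
discharged 5∕27); no summit statement is proved by this seat; conditional finite-𝕋⁴ bookkeeping; R4 closes rung `BalabanLadder.UV` only; NOT ℝ⁴, NOT infinite volume, NOT OS,
NOT a mass gap, NOT Clay.
-/

noncomputable section

namespace Summit.QuantumFields.YangMills.BalabanUVNodes.N09B12ZeroLetterFlatnessWindow

open Literature.MathematicalPhysics.QuantumFieldTheory.Balaban1983to89
open Literature.MathematicalPhysics.QuantumFieldTheory.Balaban1983to89.Node00

/-! ## §1. Generic constants: `δ₀ < (1+2β)α₀ξ′²` -/

section Generic

/-- `e^x ≤ 1 + x + x²` for `0 ≤ x ≤ 1` (Mathlib `Real.abs_exp_sub_one_sub_id_le`). [folklore] -/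
private theorem exp_le_one_add_add_sq {x : ℝ} (h0 : 0 ≤ x) (h1 : x ≤ 1) : Real.exp x ≤ 1 + x + x ^ 2 := by
  have h := Real.abs_exp_sub_one_sub_id_le (x := x) (by rwa [abs_of_nonneg h0])
  have := (abs_le.mp h).2
  linarith

/-- The polynomial inequality behind the window comparison: `(1 + (β + ⅜) + (β + ⅜)²)·β < 1 + 2β` for `0 < β ≤ ½`. [folklore] -/
private theorem window_poly {β : ℝ} (hβ : 0 < β) (hβ2 : β ≤ 1 / 2) : (1 + (β + 3 / 8) + (β + 3 / 8) ^ 2) * β < 1 + 2 * β := by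
  nlinarith [mul_le_mul_of_nonneg_left hβ2 (sq_nonneg β), mul_le_mul_of_nonneg_left hβ2 hβ.le]

/-- `(4aξ′)`-type bound: for `0 ≤ t ≤ ½`, `1 + t + t² ≤ 7∕4`. [folklore] -/
private theorem one_add_add_sq_le {t : ℝ} (h0 : 0 ≤ t) (h1 : t ≤ 1 / 2) : 1 + t + t ^ 2 ≤ 7 / 4 := by
  have : t ^ 2 ≤ 1 / 2 * (1 / 2) := by rw [pow_two]; exact mul_le_mul h1 h1 h0 (by norm_num)
  linarith

/-- **★ THE ZERO-LETTER FLATNESS IS STRICTLY INSIDE THE (1.16) WINDOW** (generic constants).  For `c : Lemma4Consts` with `0 < α₀`, `0 < β ≤ ½`, `B₃ ≥ 1`, `O(1), M ≥ 0`, print's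
restrictions `(4B₃²O(1)M)²α₀ ≤ β`, `O(1)Mα₁ ≤ β`, `B₃²O(1)Mα₀ < ½α₁` and the smallness `α₁ ≤ ¼`, and scales with `ξ·L^{j−1}η = ξ′`, `0 < ξ′ ≤ 1`: PART 1's constant
`δ₀ = e^{c_w}·(ξ²·2B₃y² + ½(4x′)²ξ²e^{ξ·4x′})` (`x′ = B₃²O(1)Mα₀L^{j−1}η`, `y = B₃O(1)Mα₀L^{j−1}η`, `c_w = O(1)Mα₁ + 2B₃O(1)Mα₀ + B₃²O(1)Mα₀`) satisfies `δ₀ < (1+2β)α₀ξ′²`.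
[cite: Balaban1987RG1, (1.16) p.262, (3.37) p.277, (3.43) p.278, Lemma 4 p.280 («sufficiently small»)] -/
theorem delta0_lt_window (c : B12Sec2to5.Lemma4Consts) {ξ η ξ' : ℝ} {j : ℕ}
    (hα₀ : 0 < c.α₀) (hβ : 0 < c.β) (hβ2 : c.β ≤ 1 / 2) (hB : 1 ≤ c.B₃) (hO : 0 ≤ c.O₁) (hM : 0 ≤ c.M)
    (h43 : (4 * c.B₃ ^ 2 * c.O₁ * c.M) ^ 2 * c.α₀ ≤ c.β) (hα₁β : c.O₁ * c.M * c.α₁ ≤ c.β)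
    (ha : c.B₃ ^ 2 * c.O₁ * c.M * c.α₀ < c.α₁ / 2) (hα₁ : c.α₁ ≤ 1 / 4)
    (hξ' : 0 < ξ') (hξ'1 : ξ' ≤ 1) (hscale : ξ * (c.L ^ (j - 1) * η) = ξ') :
    Real.exp (c.O₁ * c.M * c.α₁ + c.B₃ * c.O₁ * c.M * c.α₀ + c.B₃ * c.O₁ * c.M * c.α₀ + c.B₃ ^ 2 * c.O₁ * c.M * c.α₀) *
        (ξ ^ 2 * (2 * (c.B₃ * (c.B₃ * c.O₁ * c.M * c.α₀ * (c.L ^ (j - 1) * η)) ^ 2))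
          + 1 / 2 * (4 * (c.B₃ ^ 2 * c.O₁ * c.M * c.α₀ * (c.L ^ (j - 1) * η))) ^ 2 * ξ ^ 2
              * Real.exp (ξ * (4 * (c.B₃ ^ 2 * c.O₁ * c.M * c.α₀ * (c.L ^ (j - 1) * η))))) <
      (1 + 2 * c.β) * c.α₀ * ξ' ^ 2 := by
  set a : ℝ := c.B₃ ^ 2 * c.O₁ * c.M * c.α₀ with ha_def
  set u : ℝ := c.B₃ * c.O₁ * c.M * c.α₀ with hu_def
  set ℓ : ℝ := c.L ^ (j - 1) * η with hℓ_def
  have hB0 : 0 ≤ c.B₃ := zero_le_one.trans hB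
  have hOMα : 0 ≤ c.O₁ * c.M * c.α₀ := by positivity
  have hu0 : 0 ≤ u := by rw [hu_def]; positivity
  have ha0 : 0 ≤ a := by rw [ha_def]; positivity
  have hau : a = c.B₃ * u := by rw [ha_def, hu_def]; ring
  have hua : u ≤ a := by
    rw [hau]
    have h := mul_le_mul_of_nonneg_right hB hu0
    rw [one_mul] at h
    exact h
  have hα₁0 : 0 < c.α₁ := by linarith
  have hx0 : 0 ≤ c.O₁ * c.M * c.α₁ := by positivity
  -- the scale identity `ξℓ = ξ′`
  have h1 : ξ ^ 2 * (2 * (c.B₃ * (u * ℓ) ^ 2)) = 2 * (c.B₃ * u ^ 2) * ξ' ^ 2 := by rw [← hscale]; ring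
  have h2 : 1 / 2 * (4 * (a * ℓ)) ^ 2 * ξ ^ 2 = 8 * a ^ 2 * ξ' ^ 2 := by rw [← hscale]; ring
  have h3 : ξ * (4 * (a * ℓ)) = 4 * a * ξ' := by rw [← hscale]; ring
  rw [h1, h2, h3]
  -- `B₃u² ≤ a²`, `16a² ≤ βα₀`, `a ≤ 1/8`
  have hB2 : c.B₃ ≤ c.B₃ ^ 2 := by
    have h := mul_nonneg hB0 (sub_nonneg.mpr hB)
    have e : c.B₃ ^ 2 = c.B₃ * (c.B₃ - 1) + c.B₃ := by ring
    linarith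
  have hBu : c.B₃ * u ^ 2 ≤ a ^ 2 := by
    have e : a ^ 2 = c.B₃ ^ 2 * u ^ 2 := by rw [hau]; ring
    rw [e]
    exact mul_le_mul_of_nonneg_right hB2 (sq_nonneg u)
  have ha2 : 16 * a ^ 2 ≤ c.β * c.α₀ := by
    have e : 16 * a ^ 2 = (4 * c.B₃ ^ 2 * c.O₁ * c.M) ^ 2 * c.α₀ * c.α₀ := by rw [ha_def]; ring
    rw [e]
    exact mul_le_mul_of_nonneg_right h43 hα₀.le
  have ha8 : a ≤ 1 / 8 := by linarith
  -- the two exponentials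
  have hG : Real.exp (4 * a * ξ') ≤ 7 / 4 := by
    have h4a0 : 0 ≤ 4 * a * ξ' := by positivity
    have h4a : 4 * a * ξ' ≤ 1 / 2 :=
      calc 4 * a * ξ' ≤ 4 * a * 1 := mul_le_mul_of_nonneg_left hξ'1 (by positivity)
        _ ≤ 1 / 2 := by linarith
    exact (exp_le_one_add_add_sq h4a0 (by linarith)).trans (one_add_add_sq_le h4a0 h4a)
  have hcw : c.O₁ * c.M * c.α₁ + u + u + a ≤ c.β + 3 / 8 := by linarith
  have hE : Real.exp (c.O₁ * c.M * c.α₁ + u + u + a) ≤ 1 + (c.β + 3 / 8) + (c.β + 3 / 8) ^ 2 :=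
    (Real.exp_le_exp.mpr hcw).trans (exp_le_one_add_add_sq (by positivity) (by linarith))
  have hE0 : 0 ≤ Real.exp (c.O₁ * c.M * c.α₁ + u + u + a) := (Real.exp_pos _).le
  have hG0 : 0 ≤ Real.exp (4 * a * ξ') := (Real.exp_pos _).le
  -- assemble
  have step1 : 2 * (c.B₃ * u ^ 2) * ξ' ^ 2 + 8 * a ^ 2 * ξ' ^ 2 * Real.exp (4 * a * ξ') ≤ c.β * c.α₀ * ξ' ^ 2 := by
    have hξ2 : 0 ≤ ξ' ^ 2 := sq_nonneg _
    have t1 : 2 * (c.B₃ * u ^ 2) * ξ' ^ 2 ≤ 2 * a ^ 2 * ξ' ^ 2 :=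
      mul_le_mul_of_nonneg_right (mul_le_mul_of_nonneg_left hBu zero_le_two) hξ2
    have t2 : 8 * a ^ 2 * ξ' ^ 2 * Real.exp (4 * a * ξ') ≤ 8 * a ^ 2 * ξ' ^ 2 * (7 / 4) :=
      mul_le_mul_of_nonneg_left hG (by positivity)
    have t3 : 16 * a ^ 2 * ξ' ^ 2 ≤ c.β * c.α₀ * ξ' ^ 2 := mul_le_mul_of_nonneg_right ha2 hξ2
    linarith
  have key : (1 + (c.β + 3 / 8) + (c.β + 3 / 8) ^ 2) * c.β < 1 + 2 * c.β := window_poly hβ hβ2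
  have hpos : 0 < c.α₀ * ξ' ^ 2 := by positivity
  calc Real.exp (c.O₁ * c.M * c.α₁ + u + u + a) * (2 * (c.B₃ * u ^ 2) * ξ' ^ 2 + 8 * a ^ 2 * ξ' ^ 2 * Real.exp (4 * a * ξ'))
      ≤ Real.exp (c.O₁ * c.M * c.α₁ + u + u + a) * (c.β * c.α₀ * ξ' ^ 2) := mul_le_mul_of_nonneg_left step1 hE0
    _ ≤ (1 + (c.β + 3 / 8) + (c.β + 3 / 8) ^ 2) * (c.β * c.α₀ * ξ' ^ 2) := mul_le_mul_of_nonneg_right hE (by positivity)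
    _ = (1 + (c.β + 3 / 8) + (c.β + 3 / 8) ^ 2) * c.β * (c.α₀ * ξ' ^ 2) := by ring
    _ < (1 + 2 * c.β) * (c.α₀ * ξ' ^ 2) := mul_lt_mul_of_pos_right key hpos
    _ = (1 + 2 * c.β) * c.α₀ * ξ' ^ 2 := by ring

/-- **A6 (non-vacuity of §1's antecedent)**: the ten hypotheses on the constants are jointly satisfiable (e.g. `B₃ = O(1) = M = 1`, `β = ½`, `α₀ = 1∕64`, `α₁ = ¼`; dag-n09-c's
witness of record `β = 3∕10`, `α₁ = 3∕160`, `B₃ = 1`, `O(1) = 1∕M` satisfies them too, by inspection of `exists_residB12Run_restrictions`' proof). [folklore] -/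
theorem delta0_lt_window_hyps_inhabited : ∃ c : B12Sec2to5.Lemma4Consts,
    0 < c.α₀ ∧ 0 < c.β ∧ c.β ≤ 1 / 2 ∧ 1 ≤ c.B₃ ∧ 0 ≤ c.O₁ ∧ 0 ≤ c.M ∧ (4 * c.B₃ ^ 2 * c.O₁ * c.M) ^ 2 * c.α₀ ≤ c.β ∧
      c.O₁ * c.M * c.α₁ ≤ c.β ∧ c.B₃ ^ 2 * c.O₁ * c.M * c.α₀ < c.α₁ / 2 ∧ c.α₁ ≤ 1 / 4 :=
  ⟨⟨1, 1, 1, 2, 3 / 4, 1 / 2, 1 / 64, 1 / 4, 1, 1⟩, by norm_num⟩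

end Generic

/-! ## §2. At NODE 00's objects: the scale identity of record and `δ₀(λ) < (1+2β)α₀·ξ′²`, `ξ′ = L^{−(k+1)}` -/

section Record

variable {P : Params} {N M : ℕ}

/-- **The scale identity of record** `ξ_j·(L^{j−1}·η_k) = ξ_{k+1}` (`ξ_n = L⁻ⁿ`, `1 ≤ j`): print's «ξ·L^{j−1}η = L⁻¹η» (p. 275) with `L⁻¹η = ξ′` read on the constants of the two frames of
record (`λ.csX`, `λ.csBox`). [cite: Balaban1987RG1, p.275 (bookkeeping)] -/
theorem csX_ξ_mul_scale (lam : ResidB12Run P N M) (cB : ℝ) :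
    (lam.csX cB).ξ * (lam.consts.L ^ (lam.idx.j - 1) * lam.idx.η) = (lam.csBox cB).ξ := by
  show P.eta lam.idx.j * ((P.L : ℝ) ^ (lam.idx.j - 1) * P.eta lam.idx.k) = P.eta (lam.idx.k + 1)
  obtain ⟨m, hm⟩ := Nat.exists_eq_add_of_le lam.idx.one_le_j
  have hL : (P.L : ℝ) ≠ 0 := Sect2.L_cast_ne_zero P
  rw [hm, Nat.add_sub_cancel_left]
  simp only [Params.eta]
  rw [inv_pow, inv_pow, inv_pow]
  field_simp
  ring

/-- **★★ AT NODE 00's OBJECTS**: for a residual [B12] layer `λ` whose constants satisfy `0 < α₀`, `0 < β ≤ ½`, `B₃ ≥ 1`, `O(1) ≥ 0`, `(4B₃²O(1)M)²α₀ ≤ β`, `O(1)Mα₁ ≤ β`,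
`B₃²O(1)Mα₀ < ½α₁`, `α₁ ≤ ¼`, PART 1's `δ₀(λ)` (the bound `norm_plaq_bg_repr_sub_one_le_of_zero_letters` puts on every `X`-plaquette of the datum's pinned `(k+1)`-background of a
zero-`𝐊` package) is STRICTLY below `(1+2β)α₀·ξ′²`, `ξ′ = (λ.csBox cB).ξ = L^{−(k+1)}` — the bound condition (iv) (1.16) of `U′ᶜ_{k+1}(□₀, (1+2β)α₀, (1+2β)α₁, α₀)` puts on the
same plaquettes (`CondIV (λ.frameBox Rz).bg … (λ.csBox cB) ((1+2β)α₀)`).  So NF(δ₀(λ)) of PART 2 is compatible with admissibility; it is a condition on the pin of `bgI`.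
[cite: Balaban1987RG1, (1.16) p.262, Lemma 4 p.280 (bookkeeping on OUR constant)] -/
theorem delta0_lt_window_of_record (lam : ResidB12Run P N M) (cB : ℝ)
    (hα₀ : 0 < lam.consts.α₀) (hβ : 0 < lam.consts.β) (hβ2 : lam.consts.β ≤ 1 / 2) (hB : 1 ≤ lam.consts.B₃) (hO : 0 ≤ lam.consts.O₁)
    (h43 : (4 * lam.consts.B₃ ^ 2 * lam.consts.O₁ * lam.consts.M) ^ 2 * lam.consts.α₀ ≤ lam.consts.β)
    (hα₁β : lam.consts.O₁ * lam.consts.M * lam.consts.α₁ ≤ lam.consts.β)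
    (ha : lam.consts.B₃ ^ 2 * lam.consts.O₁ * lam.consts.M * lam.consts.α₀ < lam.consts.α₁ / 2) (hα₁ : lam.consts.α₁ ≤ 1 / 4) :
    Real.exp (lam.consts.O₁ * lam.consts.M * lam.consts.α₁ + lam.consts.B₃ * lam.consts.O₁ * lam.consts.M * lam.consts.α₀
          + lam.consts.B₃ * lam.consts.O₁ * lam.consts.M * lam.consts.α₀ + lam.consts.B₃ ^ 2 * lam.consts.O₁ * lam.consts.M * lam.consts.α₀) *
        ((lam.csX cB).ξ ^ 2 * (2 * (lam.consts.B₃ * (lam.consts.B₃ * lam.consts.O₁ * lam.consts.M * lam.consts.α₀ * (lam.consts.L ^ (lam.idx.j - 1) * lam.idx.η)) ^ 2))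
          + 1 / 2 * (4 * (lam.consts.B₃ ^ 2 * lam.consts.O₁ * lam.consts.M * lam.consts.α₀ * (lam.consts.L ^ (lam.idx.j - 1) * lam.idx.η))) ^ 2 * (lam.csX cB).ξ ^ 2
              * Real.exp ((lam.csX cB).ξ * (4 * (lam.consts.B₃ ^ 2 * lam.consts.O₁ * lam.consts.M * lam.consts.α₀ * (lam.consts.L ^ (lam.idx.j - 1) * lam.idx.η))))) <
      (1 + 2 * lam.consts.β) * lam.consts.α₀ * (lam.csBox cB).ξ ^ 2 := by
  have hM : 0 ≤ lam.consts.M := Nat.cast_nonneg M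
  -- `0 < ξ′ = L^{−(k+1)} ≤ 1`
  have hLpos : 0 < (P.L : ℝ) := Nat.cast_pos.mpr P.L_pos
  have hξ' : 0 < (lam.csBox cB).ξ := pow_pos (inv_pos.mpr hLpos) _
  have hξ'1 : (lam.csBox cB).ξ ≤ 1 :=
    pow_le_one₀ (inv_nonneg.mpr hLpos.le) (inv_le_one_of_one_le₀ (by exact_mod_cast P.L_pos))
  exact delta0_lt_window lam.consts hα₀ hβ hβ2 hB hO hM h43 hα₁β ha hα₁ hξ' hξ'1 (csX_ξ_mul_scale lam cB)

end Record

end Summit.QuantumFields.YangMills.BalabanUVNodes.N09B12ZeroLetterFlatnessWindow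

end
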